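import Summits.BirchSwinnertonDyer.BirchSwinnertonDyer.Theorems.BiquadraticEisensteinDescentHeegnerTwistCouplingInSupplySplitPrimeOrder
import Mathlib.Analysis.SpecialFunctions.Log.Basic
import HarnessLib

set_option linter.dupNamespace false -- `Summit.BirchSwinnertonDyer.BirchSwinnertonDyer.Theorems.…` (summit = sub, D-0017)
set_option autoImplicit false

/-!
# Crux `HeegnerTwistCouplingInSupply` (stmt-BirchSwinnertonDyer-21381), card `genus-doubling-free-box` —
# Oesterlé §1.4 a) AT THE ORDER of a split prime class; exact order from a primitive element of prime-power norm

Route `BiquadraticEisensteinDescent` (cell `pub/bsd-wall`; width seat `bsd-wall-cm-bed-w4` g25; theorems only,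
`--supports 21381`). Sequel of `…SplitPrimeOrder.lean` (split data, `(π) = 𝔭ⁿ` for primitive `π` of norm `pⁿ`).

* §4 ★ `natAbs_discr_le_four_mul_pow_of_isPrincipal` / `natAbs_discr_le_four_mul_pow_orderOf` — Oesterlé 1985
  §1.4 a) («si `p` est décomposé dans `K`, on a `p^h ≥ d/4`») sharpened from the exponent `h_K` to ANY `k ≥ 1` with
  `𝔭^k` principal, in particular to `k = ord[𝔭]`: `|d_K| ≤ 4·p^{ord[𝔭]}` for `K` imaginary quadratic (the printed
  proof verbatim: `𝔭^k = (π)`, `π ∉ ℤ`, `p^k = N(π) ≥ |d_K|/4`; the tree's `natAbs_discr_le_four_mul_pow_classNumber`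
  (`Literature/…/OesterleSplitPrimeBound.lean`) is the case `k = h_K`); log form `log_div_four_le_orderOf_mul_log`.
* §5 ★ `exists_orderOf_eq_of_norm_eq_pow` — `|N(π)| = pⁿ`, `π ∉ p𝓞_K`, `n ≥ 1` and `|d_K| > 4·p^{n−1}` ⟹ the class of
  one prime above `p` has order EXACTLY `n`, so `n ∣ h_K` (`dvd_classNumber_of_norm_eq_pow`). This is the class-number
  divisibility mechanism of the Nagell / Ankeny–Chowla families `d = x² − 4ℓⁿ` and of the card's Mersenne family
  `d = x² − 2ⁿ` (`ord[𝔭₂] = n − 2`), instantiated in `…SplitPrimeOrderFamilies.lean`.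

HONEST FRAMING: class-group bookkeeping for the `h`-side certificate of a RELIEF lever; nothing here touches
`L(W^d, 1)`, C⁺, the crux `HeegnerTwistCouplingInSupply`, or BSD. No definition, no named fact, no `sorry`; axioms standard.
[cite: Oesterle1985, §1.4 a) (p. 312)] [cite: Cox2013, §5.B Prop. 5.16, §7.B Thm. 7.7]
-/

noncomputable section

open scoped Classical NumberTheorySymbols nonZeroDivisors
open Module NumberField Ideal IsDedekindDomain
open Literature.NumberTheory.QuadraticFields Literature.NumberTheory.QuadraticFields.Quadratic

namespace Summit.BirchSwinnertonDyer.BirchSwinnertonDyer.Theorems.SplitPrimeOrder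

variable {K : Type*} [Field K] [NumberField K]

/-! ## §4 Oesterlé §1.4 a) at the order of the class -/

/-- **`𝔭^k` principal with `k ≥ 1` forces `|d_K| ≤ 4·p^k`** (`K` imaginary quadratic, `p` split, `𝔭 ∣ p`): the printed
argument of Oesterlé 1985 §1.4 a) with the exponent `h` replaced by any `k ≥ 1` — `𝔭^k = (π)`, and `π` is not a rational
integer (else `π = x`, `x² = p^k`, `p ∣ x`, `𝔭^k = (x) ⊆ (p) ⊆ 𝔭'`, forcing `𝔭 = 𝔭'`), so `p^k = N(π) ≥ |d_K|/4`
(the tree's `natAbs_discr_le_four_mul_natAbs_norm`, inlined). [cite: Oesterle1985, §1.4 a) (p. 312)] -/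
theorem natAbs_discr_le_four_mul_pow_of_isPrincipal (h2 : finrank ℚ K = 2)
    (hneg : NumberField.discr K < 0) {p : ℕ} (hp : p.Prime)
    (hcount : ((span {(p : ℤ)}).primesOver (𝓞 K)).ncard = 2)
    (hnorm : ∀ P ∈ (span {(p : ℤ)}).primesOver (𝓞 K), absNorm P = p)
    {P : Ideal (𝓞 K)} (hP : P ∈ (span {(p : ℤ)}).primesOver (𝓞 K))
    {k : ℕ} (hk : 1 ≤ k) (hprinc : (P ^ k).IsPrincipal) :
    (NumberField.discr K).natAbs ≤ 4 * p ^ k := by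
  obtain ⟨b, hb⟩ := exists_basis_zero_eq_one h2
  -- the other prime `P' ≠ P` above `p`
  obtain ⟨P₁, P₂, hne12, hPP⟩ := Set.ncard_eq_two.mp hcount
  obtain ⟨P', hP', hne⟩ : ∃ P' ∈ (span {(p : ℤ)}).primesOver (𝓞 K), P ≠ P' := by
    have hP₁ : P₁ ∈ (span {(p : ℤ)}).primesOver (𝓞 K) := by rw [hPP]; exact Set.mem_insert _ _
    have hP₂ : P₂ ∈ (span {(p : ℤ)}).primesOver (𝓞 K) := by
      rw [hPP]; exact Set.mem_insert_of_mem _ (Set.mem_singleton _)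
    have hmem : P ∈ ({P₁, P₂} : Set (Ideal (𝓞 K))) := hPP ▸ hP
    rcases hmem with rfl | h
    · exact ⟨P₂, hP₂, hne12⟩
    · rw [Set.mem_singleton_iff] at h
      subst h
      exact ⟨P₁, hP₁, hne12.symm⟩
  haveI hPprime : P.IsPrime := hP.1
  haveI hP'prime : P'.IsPrime := hP'.1
  have hNP : absNorm P = p := hnorm P hP
  have hPbot : P ≠ ⊥ := ne_bot_of_absNorm_eq_prime hp hNP
  have hpP' : (p : 𝓞 K) ∈ P' := natCast_mem_of_mem_primesOver hP'
  obtain ⟨π, hπ⟩ := hprinc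
  have hπ' : P ^ k = span {π} := hπ
  -- `|N(π)| = p^k`
  have hNπ : (Algebra.norm ℤ π).natAbs = p ^ k := by
    rw [← Ideal.absNorm_span_singleton, ← hπ', map_pow, hNP]
  -- the `ω`-coordinate of `π` is non-zero
  have hy : b.repr π 1 ≠ 0 := by
    intro hy0
    set x : ℤ := b.repr π 0 with hx
    have hπx : π = (x : 𝓞 K) := by
      conv_lhs => rw [← b.sum_repr π]
      rw [Fin.sum_univ_two, hb, hy0, zero_smul, add_zero, zsmul_eq_mul, mul_one]
    have hNx : Algebra.norm ℤ π = x ^ 2 := by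
      rw [hπx, show ((x : 𝓞 K)) = algebraMap ℤ (𝓞 K) x from rfl, Algebra.norm_algebraMap_of_basis b]
      simp
    have hx2 : x ^ 2 = (p : ℤ) ^ k := by
      have := hNπ
      rw [hNx, Int.natAbs_pow] at this
      have h3 : (x.natAbs : ℤ) ^ 2 = (p : ℤ) ^ k := by exact_mod_cast this
      rw [Int.natAbs_sq] at h3
      exact h3
    have hpx : (p : ℤ) ∣ x := by
      have hpr : Prime (p : ℤ) := Int.prime_iff_natAbs_prime.mpr (by simpa using hp)
      refine hpr.dvd_of_dvd_pow (n := 2) ?_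
      rw [hx2]
      exact dvd_pow_self _ (by omega)
    obtain ⟨c, hc⟩ := hpx
    have hle : P ^ k ≤ P' := by
      rw [hπ', Ideal.span_singleton_le_iff_mem, hπx, hc]
      push_cast
      exact P'.mul_mem_right _ hpP'
    have hle' : P ≤ P' := (Ideal.IsPrime.pow_le_iff (by omega)).mp hle
    have hmax : P.IsMaximal := Ideal.IsPrime.isMaximal hPprime hPbot
    exact hne (hmax.eq_of_le hP'prime.ne_top hle')
  -- `p^k = N(π) ≥ |d_K|/4`: `4N(x + yω) = (2x + ty)² − d_K y²` with `y ≠ 0` (tree lemma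
  -- `natAbs_discr_le_four_mul_natAbs_norm` of `OesterleSplitPrimeBound.lean`, inlined)
  rw [← hNπ]
  set m : ℤ := b.repr (b 1 * b 1) 0 with hm
  set t : ℤ := b.repr (b 1 * b 1) 1 with ht
  set x : ℤ := b.repr π 0 with hx
  set y : ℤ := b.repr π 1 with hy'
  have hπxy : π = (x : 𝓞 K) + (y : 𝓞 K) * b 1 := by
    conv_lhs => rw [← b.sum_repr π]
    rw [Fin.sum_univ_two, hb, zsmul_eq_mul, mul_one, zsmul_eq_mul]
  have hω : b 1 * b 1 = (m : 𝓞 K) + (t : 𝓞 K) * b 1 := basis_one_mul_self_eq b hb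
  have hN : Algebra.norm ℤ π = x ^ 2 + t * x * y - m * y ^ 2 := by
    rw [hπxy, norm_intCast_add_intCast_mul b hb hω]
  have hD : NumberField.discr K = t ^ 2 + 4 * m := discr_eq_sq_add_four_mul b hb
  have hy1 : 1 ≤ y ^ 2 := by
    have : 0 < y ^ 2 := by positivity
    omega
  have hnonneg : 0 ≤ Algebra.norm ℤ π := by
    rw [hN]; nlinarith [sq_nonneg (2 * x + t * y), sq_nonneg y]
  have key : -(NumberField.discr K) ≤ 4 * Algebra.norm ℤ π := by
    rw [hN, hD]
    nlinarith [sq_nonneg (2 * x + t * y), hy1]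
  have h1 : ((NumberField.discr K).natAbs : ℤ) = -NumberField.discr K :=
    Int.ofNat_natAbs_of_nonpos hneg.le
  have h2 : ((Algebra.norm ℤ π).natAbs : ℤ) = Algebra.norm ℤ π := Int.natAbs_of_nonneg hnonneg
  omega

/-- ★ **Oesterlé §1.4 a) AT THE ORDER**: for `K` imaginary quadratic, `p` split in `K` and `𝔭 ∣ p`,
`|d_K| ≤ 4 · p^{ord[𝔭]}` — the order of the class of `𝔭` is at least `log_p(|d_K|/4)` (the class has finite order,
`𝔭^{ord[𝔭]}` is principal and `ord[𝔭] ≥ 1`). The printed statement is the weaker `p^{h_K} ≥ |d_K|/4`.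
[cite: Oesterle1985, §1.4 a) (p. 312)] -/
theorem natAbs_discr_le_four_mul_pow_orderOf (h2 : finrank ℚ K = 2)
    (hneg : NumberField.discr K < 0) {p : ℕ} (hp : p.Prime)
    (hcount : ((span {(p : ℤ)}).primesOver (𝓞 K)).ncard = 2)
    (hnorm : ∀ P ∈ (span {(p : ℤ)}).primesOver (𝓞 K), absNorm P = p)
    {P : Ideal (𝓞 K)} (hP : P ∈ (span {(p : ℤ)}).primesOver (𝓞 K)) (hP0 : P ∈ (Ideal (𝓞 K))⁰) :
    (NumberField.discr K).natAbs ≤ 4 * p ^ orderOf (ClassGroup.mk0 ⟨P, hP0⟩) := by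
  set g := ClassGroup.mk0 (⟨P, hP0⟩ : (Ideal (𝓞 K))⁰) with hg
  have hk : 1 ≤ orderOf g := orderOf_pos g
  refine natAbs_discr_le_four_mul_pow_of_isPrincipal h2 hneg hp hcount hnorm hP hk ?_
  have hPk0 : P ^ orderOf g ∈ (Ideal (𝓞 K))⁰ := pow_mem hP0 _
  have heq : (⟨P ^ orderOf g, hPk0⟩ : (Ideal (𝓞 K))⁰) = ⟨P, hP0⟩ ^ orderOf g := Subtype.ext (by simp)
  have h1 : ClassGroup.mk0 (⟨P ^ orderOf g, hPk0⟩ : (Ideal (𝓞 K))⁰) = 1 := by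
    rw [heq, map_pow, ← hg, pow_orderOf_eq_one]
  exact (ClassGroup.mk0_eq_one_iff hPk0).mp h1

/-- **Logarithmic form**: `log(|d_K|/4) ≤ ord[𝔭] · log p` for a split prime `p` and `𝔭 ∣ p` (`K` imaginary quadratic).
[cite: Oesterle1985, §1.4 a) (p. 312)] -/
theorem log_div_four_le_orderOf_mul_log (h2 : finrank ℚ K = 2)
    (hneg : NumberField.discr K < 0) {p : ℕ} (hp : p.Prime)
    (hcount : ((span {(p : ℤ)}).primesOver (𝓞 K)).ncard = 2)
    (hnorm : ∀ P ∈ (span {(p : ℤ)}).primesOver (𝓞 K), absNorm P = p)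
    {P : Ideal (𝓞 K)} (hP : P ∈ (span {(p : ℤ)}).primesOver (𝓞 K)) (hP0 : P ∈ (Ideal (𝓞 K))⁰) :
    Real.log (((NumberField.discr K).natAbs : ℝ) / 4) ≤
      (orderOf (ClassGroup.mk0 ⟨P, hP0⟩) : ℝ) * Real.log p := by
  have h := natAbs_discr_le_four_mul_pow_orderOf h2 hneg hp hcount hnorm hP hP0
  have hR : ((NumberField.discr K).natAbs : ℝ) / 4 ≤ (p : ℝ) ^ orderOf (ClassGroup.mk0 ⟨P, hP0⟩) := by
    rw [div_le_iff₀ (by norm_num : (0 : ℝ) < 4)]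
    exact_mod_cast (mul_comm 4 _ ▸ h)
  have hd0 : (0 : ℝ) < (NumberField.discr K).natAbs := by
    have : NumberField.discr K ≠ 0 := NumberField.discr_ne_zero K
    positivity
  rw [← Real.log_pow]
  exact Real.log_le_log (by positivity) hR

/-! ## §5 Exact order from a primitive element of prime-power norm -/

/-- ★ **Exact order.** `K` imaginary quadratic, `p` split, `π ∈ 𝓞 K` with `|N(π)| = pⁿ`, `π ∉ p𝓞_K`, `n ≥ 1`, and
`|d_K| > 4·p^{n−1}`: then `(π) = 𝔭ⁿ` for a prime `𝔭 ∣ p` whose class has order EXACTLY `n` (`ord ∣ n` from §3,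
`p^{ord} ≥ |d_K|/4 > p^{n−1}` from §4). [cite: Oesterle1985, §1.4 a) (p. 312)] [cite: Cox2013, §7.B Thm. 7.7] -/
theorem exists_orderOf_eq_of_norm_eq_pow (h2 : finrank ℚ K = 2)
    (hneg : NumberField.discr K < 0) {p : ℕ} (hp : p.Prime)
    (hcount : ((span {(p : ℤ)}).primesOver (𝓞 K)).ncard = 2)
    (hnorm : ∀ P ∈ (span {(p : ℤ)}).primesOver (𝓞 K), absNorm P = p)
    {π : 𝓞 K} {n : ℕ} (hn : 1 ≤ n) (hNπ : (Algebra.norm ℤ π).natAbs = p ^ n)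
    (hπp : π ∉ span {(p : 𝓞 K)}) (hbig : 4 * p ^ (n - 1) < (NumberField.discr K).natAbs) :
    ∃ P ∈ (span {(p : ℤ)}).primesOver (𝓞 K), ∃ hP0 : P ∈ (Ideal (𝓞 K))⁰,
      span {π} = P ^ n ∧ orderOf (ClassGroup.mk0 ⟨P, hP0⟩) = n := by
  obtain ⟨P, hP, heq⟩ := exists_span_singleton_eq_pow h2 hp hcount hnorm hNπ hπp
  have hP0 : P ∈ (Ideal (𝓞 K))⁰ :=
    mem_nonZeroDivisors_iff_ne_zero.mpr (ne_bot_of_absNorm_eq_prime hp (hnorm P hP))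
  refine ⟨P, hP, hP0, heq, ?_⟩
  have hdvd := orderOf_dvd_of_span_singleton_eq_pow hP0 heq
  have hle : orderOf (ClassGroup.mk0 ⟨P, hP0⟩) ≤ n := Nat.le_of_dvd (by omega) hdvd
  have hbound := natAbs_discr_le_four_mul_pow_orderOf h2 hneg hp hcount hnorm hP hP0
  have hlt : p ^ (n - 1) < p ^ orderOf (ClassGroup.mk0 ⟨P, hP0⟩) := by
    have := hbig.trans_le hbound
    omega
  have hge : n - 1 < orderOf (ClassGroup.mk0 ⟨P, hP0⟩) := (Nat.pow_lt_pow_iff_right hp.one_lt).mp hlt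
  omega

/-- ★ **`n ∣ h_K`** under the hypotheses of `exists_orderOf_eq_of_norm_eq_pow` (Lagrange). This is the class-number
divisibility mechanism of the families `d = x² − 4ℓⁿ` (Nagell, Ankeny–Chowla) and, at `p = 2`, of the card's Mersenne
family `d = x² − 2ⁿ`. [cite: Oesterle1985, §1.4 a) (p. 312)] [cite: Cox2013, §7.B Thm. 7.7] -/
theorem dvd_classNumber_of_norm_eq_pow (h2 : finrank ℚ K = 2)
    (hneg : NumberField.discr K < 0) {p : ℕ} (hp : p.Prime)
    (hcount : ((span {(p : ℤ)}).primesOver (𝓞 K)).ncard = 2)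
    (hnorm : ∀ P ∈ (span {(p : ℤ)}).primesOver (𝓞 K), absNorm P = p)
    {π : 𝓞 K} {n : ℕ} (hn : 1 ≤ n) (hNπ : (Algebra.norm ℤ π).natAbs = p ^ n)
    (hπp : π ∉ span {(p : 𝓞 K)}) (hbig : 4 * p ^ (n - 1) < (NumberField.discr K).natAbs) :
    n ∣ NumberField.classNumber K := by
  obtain ⟨P, -, hP0, -, hord⟩ := exists_orderOf_eq_of_norm_eq_pow h2 hneg hp hcount hnorm hn hNπ hπp hbig
  rw [← hord, NumberField.classNumber]
  exact orderOf_dvd_card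

end Summit.BirchSwinnertonDyer.BirchSwinnertonDyer.Theorems.SplitPrimeOrder

end
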